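import Summits.FinalStateConjecture.FinalStateConjecture.Theorems.SwallowTheDatumUniversalWitnessFamilyRegionOneAnalysis
import Mathlib.Analysis.Calculus.Deriv.MeanValue

/-!
# Crux `SwallowTheDatum.UniversalWitnessFamily` (stmt-FinalStateConjecture-10051), line `Sketch`,
# stub `stub_regionOneDecomposition` — part 5: calculus of the bending `bend M t r = torH(r)·χ(r/S(t) − 1)`

* `exists_bound_deriv_smoothTransition` — `|χ'| ≤ C` on `ℝ` for Mathlib's `Real.smoothTransition`
  (`χ' = 0` off `(0, 1)`, compactness on `[0, 1]`);
* `hasDerivAt_growth`, `deriv_exactRadius_div_le` — `S'(t)/S(t) ≤ 1/(2t)` for `t > 0`;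
* `bend_nonneg`, `bend_le_torH_two_mul` — `0 ≤ bend ≤ torH(2S(t))` on `{r > 2M}`;
* `hasDerivAt_bend_t`, `abs_deriv_bend_t_le` — `|∂_t bend| ≤ 2C·torH(2S(t))·S'(t)/S(t)`, and
  `exists_time_deriv_bend_small`: there is `τ♭ ≥ 25M` beyond which `|∂_t bend| ≤ 1/2`, so that the
  fibre maps `t ↦ t + bend M t r` are strictly increasing (`strictMonoOn_add_bend`) and the image of the
  bent map has nonnegative static time (`staticTime_bent_nonneg`: `t + bend − torH(r) ≥ 0` for `t ≥ τ♭`).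

References: MTW 1973, §31.4; O'Neill 1983, Ch. 13 (all elementary real analysis here).
-/

set_option linter.dupNamespace false

noncomputable section

open scoped Topology
open Set Function Filter Literature.Geometry.Lorentzian

namespace Summit.FinalStateConjecture.FinalStateConjecture.Theorems.SwallowTheDatum.UniversalWitnessFamily

/-! ## A global bound on the derivative of `Real.smoothTransition` -/

/-- `χ' = 0` on `(−∞, 0)` and on `(1, ∞)` (locally constant there), hence — the zero set of the
continuous `χ'` being closed — on `(−∞, 0] ∪ [1, ∞)`. -/
theorem deriv_smoothTransition_eq_zero {u : ℝ} (hu : u ≤ 0 ∨ 1 ≤ u) : deriv Real.smoothTransition u = 0 := by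
  have hcont : Continuous (deriv Real.smoothTransition) :=
    (Real.smoothTransition.contDiff (n := 1)).continuous_deriv le_rfl
  have hclosed : IsClosed {u : ℝ | deriv Real.smoothTransition u = 0} := isClosed_eq hcont continuous_const
  have hneg : Set.Iio (0 : ℝ) ⊆ {u | deriv Real.smoothTransition u = 0} := by
    intro v hv
    have hev : Real.smoothTransition =ᶠ[𝓝 v] fun _ ↦ (0 : ℝ) := by
      filter_upwards [Iio_mem_nhds hv] with w hw
      exact Real.smoothTransition.zero_of_nonpos hw.le
    show deriv Real.smoothTransition v = 0
    rw [hev.deriv_eq, deriv_const]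
  have hpos : Set.Ioi (1 : ℝ) ⊆ {u | deriv Real.smoothTransition u = 0} := by
    intro v hv
    have hev : Real.smoothTransition =ᶠ[𝓝 v] fun _ ↦ (1 : ℝ) := by
      filter_upwards [Ioi_mem_nhds hv] with w hw
      exact Real.smoothTransition.one_of_one_le hw.le
    show deriv Real.smoothTransition v = 0
    rw [hev.deriv_eq, deriv_const]
  rcases hu with hu | hu
  · have : u ∈ closure (Set.Iio (0 : ℝ)) := by rw [closure_Iio]; exact hu
    exact (hclosed.closure_subset_iff.2 hneg) this
  · have : u ∈ closure (Set.Ioi (1 : ℝ)) := by rw [closure_Ioi]; exact hu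
    exact (hclosed.closure_subset_iff.2 hpos) this

/-- **A global bound `|χ'| ≤ C`** for Mathlib's smooth transition `χ`. -/
theorem exists_bound_deriv_smoothTransition :
    ∃ C : ℝ, 0 ≤ C ∧ ∀ u : ℝ, |deriv Real.smoothTransition u| ≤ C := by
  have hcont : Continuous (deriv Real.smoothTransition) :=
    (Real.smoothTransition.contDiff (n := 1)).continuous_deriv le_rfl
  obtain ⟨C, hC⟩ := isCompact_Icc.exists_bound_of_continuousOn (s := Set.Icc (0 : ℝ) 1) hcont.continuousOn
  refine ⟨max C 0, le_max_right _ _, fun u ↦ ?_⟩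
  by_cases hu : u ∈ Set.Icc (0 : ℝ) 1
  · exact (hC u hu).trans (le_max_left _ _)
  · have hu' : u ≤ 0 ∨ 1 ≤ u := by
      rw [Set.mem_Icc, not_and_or, not_le, not_le] at hu
      rcases hu with hu | hu
      · exact Or.inl hu.le
      · exact Or.inr hu.le
    rw [deriv_smoothTransition_eq_zero hu', abs_zero]
    exact le_max_right _ _

/-! ## The derivative of the growth profile and of the exact-zone radius -/

/-- `growth' (t) = (t/M) / (2 (1 + (t/M)²)^{3/4})`, written with nested square roots. -/
theorem hasDerivAt_growth {M : ℝ} (hM : 0 < M) (t : ℝ) :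
    HasDerivAt (growth M)
      (t / M / (2 * Real.sqrt (1 + (t / M) ^ 2) * Real.sqrt (Real.sqrt (1 + (t / M) ^ 2)))) t := by
  set u := 1 + (t / M) ^ 2 with hu
  have hu0 : 0 < u := by rw [hu]; nlinarith [sq_nonneg (t / M)]
  have hsu : 0 < Real.sqrt u := Real.sqrt_pos.2 hu0
  have hssu : 0 < Real.sqrt (Real.sqrt u) := Real.sqrt_pos.2 hsu
  have h1 : HasDerivAt (fun t : ℝ ↦ 1 + (t / M) ^ 2) (2 * (t / M) * (1 / M)) t := by
    have := ((hasDerivAt_id t).div_const M).pow 2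
    simpa using this.const_add 1
  have h2 := h1.sqrt hu0.ne'
  have h3 := h2.sqrt (by rw [← hu]; exact hsu.ne')
  have h4 := h3.const_mul M
  have hfun : (fun t : ℝ ↦ M * Real.sqrt (Real.sqrt (1 + (t / M) ^ 2))) = growth M := rfl
  rw [hfun] at h4
  refine h4.congr_deriv ?_
  rw [← hu]
  field_simp

/-- **`S'(t) ≤ S(t)/(2t)`** for `t > 0` (`S = 4M + 4 growth`, `growth' /growth ≤ σ/(1 + σ²) /M ≤ 1/(2t)`·2…);
stated as `deriv S t * (2 t) ≤ S t`. -/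
theorem deriv_exactRadius_mul_le {M : ℝ} (hM : 0 < M) {t : ℝ} (ht : 0 < t) :
    deriv (exactRadius M) t * (2 * t) ≤ exactRadius M t := by
  have hg := hasDerivAt_growth hM t
  have hS : HasDerivAt (exactRadius M)
      (4 * (t / M / (2 * Real.sqrt (1 + (t / M) ^ 2) * Real.sqrt (Real.sqrt (1 + (t / M) ^ 2))))) t :=
    (hg.const_mul 4).const_add (4 * M)
  rw [hS.deriv]
  set u := 1 + (t / M) ^ 2 with hu
  have hu1 : 1 ≤ u := by rw [hu]; nlinarith [sq_nonneg (t / M)]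
  have hsu : 0 < Real.sqrt u := Real.sqrt_pos.2 (by linarith)
  have hssu : 0 < Real.sqrt (Real.sqrt u) := Real.sqrt_pos.2 hsu
  have e1 : Real.sqrt u * Real.sqrt u = u := Real.mul_self_sqrt (by linarith)
  have e2 : Real.sqrt (Real.sqrt u) * Real.sqrt (Real.sqrt u) = Real.sqrt u := Real.mul_self_sqrt hsu.le
  have e3 : Real.sqrt (Real.sqrt u) * (Real.sqrt u * Real.sqrt (Real.sqrt u)) = u := by
    calc Real.sqrt (Real.sqrt u) * (Real.sqrt u * Real.sqrt (Real.sqrt u))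
        = Real.sqrt u * (Real.sqrt (Real.sqrt u) * Real.sqrt (Real.sqrt u)) := by ring
      _ = u := by rw [e2, e1]
  set σ := t / M with hσ
  have ht' : t = M * σ := by rw [hσ]; field_simp
  have hσ2 : σ ^ 2 ≤ u := by rw [hu]; nlinarith
  rw [exactRadius_eq, growth_eq, ← hu, ht']
  have hden : 0 < Real.sqrt u * Real.sqrt (Real.sqrt u) := by positivity
  have step : σ ^ 2 / (Real.sqrt u * Real.sqrt (Real.sqrt u)) ≤ Real.sqrt (Real.sqrt u) := by
    rw [div_le_iff₀ hden, e3]; exact hσ2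
  calc 4 * (σ / (2 * Real.sqrt u * Real.sqrt (Real.sqrt u))) * (2 * (M * σ))
      = 4 * M * (σ ^ 2 / (Real.sqrt u * Real.sqrt (Real.sqrt u))) := by
        field_simp
    _ ≤ 4 * M * Real.sqrt (Real.sqrt u) := by gcongr
    _ ≤ 4 * M + 4 * (M * Real.sqrt (Real.sqrt u)) := by nlinarith

/-- `S` is differentiable. -/
theorem differentiableAt_exactRadius (M : ℝ) (t : ℝ) : DifferentiableAt ℝ (exactRadius M) t :=
  ((contDiff_exactRadius M (n := 1)).differentiable (by norm_num)).differentiableAt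

/-- `S' ≥ 0` on `t ≥ 0` is not needed; we record `0 ≤ S'(t) · t`-free form: `|S'(t)| · (2t) ≤ S(t)` for
`t > 0` with `S' ≥ 0` there. -/
theorem deriv_exactRadius_nonneg {M : ℝ} (hM : 0 < M) {t : ℝ} (ht : 0 ≤ t) : 0 ≤ deriv (exactRadius M) t := by
  have hg := hasDerivAt_growth hM t
  have hS : HasDerivAt (exactRadius M)
      (4 * (t / M / (2 * Real.sqrt (1 + (t / M) ^ 2) * Real.sqrt (Real.sqrt (1 + (t / M) ^ 2))))) t :=
    (hg.const_mul 4).const_add (4 * M)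
  rw [hS.deriv]
  have : 0 ≤ t / M := div_nonneg ht hM.le
  positivity

/-! ## Size of the bending -/

/-- `bend ≥ 0` on `{r > 2M}` (it vanishes where `torH < 0`, i.e. on `r < 4M < S`). -/
theorem bend_nonneg {M : ℝ} (t r : ℝ) (hM : 0 < M) : 0 ≤ bend M t r := by
  by_cases h4 : 4 * M ≤ r
  · exact mul_nonneg (torH_nonneg hM h4) (Real.smoothTransition.nonneg _)
  · rw [bend_eq_zero_of_le hM]
    have : 4 * M < exactRadius M t := by
      rw [exactRadius_eq]; linarith [growth_pos hM t]
    linarith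

/-- `bend M t r ≤ torH M (2 S(t))` on `{r > 2M}` (the cut-off vanishes beyond `2S`, `torH` is monotone,
and `bend ≤ torH ≤ torH(2S)` below). More useful: `bend M t r ≤ max (torH M r) 0`. -/
theorem bend_le_torH {M t r : ℝ} (hM : 0 < M) (hr : 4 * M ≤ r) : bend M t r ≤ torH M r := by
  rw [bend_eq]
  exact mul_le_of_le_one_right (torH_nonneg hM hr) (Real.smoothTransition.le_one _)

/-- `torH(r) − bend ≤ torH(2S(t))` for `4M ≤ r` (zero beyond `2S`, at most `torH(r) ≤ torH(2S)` inside). -/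
theorem torH_sub_bend_le {M t r : ℝ} (hM : 0 < M) (hr : 4 * M ≤ r) :
    torH M r - bend M t r ≤ torH M (2 * exactRadius M t) := by
  by_cases h2 : 2 * exactRadius M t ≤ r
  · rw [bend_eq_torH_of_le hM h2, sub_self]
    exact torH_nonneg hM (by linarith [two_mul_lt_exactRadius hM t, le_growth hM t, exactRadius_eq M t])
  · have hle : r ≤ 2 * exactRadius M t := (not_le.1 h2).le
    calc torH M r - bend M t r ≤ torH M r := by linarith [bend_nonneg t r hM]
      _ ≤ torH M (2 * exactRadius M t) := torH_le_torH hM (by linarith) hle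

/-- `torH(2S(t)) ≤ 4M √(7 + 4√(t/M))` for `t ≥ 0`. -/
theorem torH_two_mul_exactRadius_le {M : ℝ} (hM : 0 < M) {t : ℝ} (ht : 0 ≤ t) :
    torH M (2 * exactRadius M t) ≤ 4 * M * Real.sqrt (7 + 4 * Real.sqrt (t / M)) := by
  have hS : 2 * M < 2 * exactRadius M t := by linarith [two_mul_lt_exactRadius hM t, exactRadius_pos hM t]
  refine (torH_le_sqrt hM hS).trans ?_
  refine mul_le_mul_of_nonneg_left (Real.sqrt_le_sqrt ?_) (by positivity)
  rw [exactRadius_eq]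
  have hg := growth_le hM ht
  have : 2 * (4 * M + 4 * growth M t) / (2 * M) - 1 = 3 + 4 * (growth M t / M) := by
    field_simp; ring
  rw [this]
  have : growth M t / M ≤ 1 + Real.sqrt (t / M) := by
    rw [div_le_iff₀ hM]; linarith
  linarith

/-! ## The `t`-derivative of the bending -/

/-- `∂_t bend M t r = torH(r) · χ'(r/S(t) − 1) · (−r S'(t)/S(t)²)`. -/
theorem hasDerivAt_bend_t {M : ℝ} (hM : 0 < M) (t r : ℝ) :
    HasDerivAt (fun t ↦ bend M t r)
      (torH M r * (deriv Real.smoothTransition (r / exactRadius M t - 1) *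
        (-(r * deriv (exactRadius M) t) / exactRadius M t ^ 2))) t := by
  have hS := (differentiableAt_exactRadius M t).hasDerivAt
  have hSpos := exactRadius_pos hM t
  have h1 : HasDerivAt (fun t ↦ r / exactRadius M t - 1) (-(r * deriv (exactRadius M) t) / exactRadius M t ^ 2) t := by
    have := (hS.inv hSpos.ne').const_mul r
    have h2 : HasDerivAt (fun t ↦ r / exactRadius M t) (-(r * deriv (exactRadius M) t) / exactRadius M t ^ 2) t := by
      refine (this.congr_deriv ?_).congr_of_eventuallyEq ?_
      · field_simp
      · exact Eventually.of_forall fun y ↦ by simp [div_eq_mul_inv]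
    simpa using h2.sub_const 1
  have hχ : HasDerivAt Real.smoothTransition (deriv Real.smoothTransition (r / exactRadius M t - 1))
      (r / exactRadius M t - 1) :=
    ((Real.smoothTransition.contDiff (n := 1)).differentiable (by norm_num)).differentiableAt.hasDerivAt
  have h3 := hχ.comp t h1
  exact (h3.const_mul (torH M r))

/-- **The bound on `∂_t bend`**: on `{r > 2M}`, `t > 0`,
`|∂_t bend| ≤ torH(2S(t)) · C · 2 · S'(t)/S(t) ≤ C · torH(2S(t)) / t`. -/
theorem abs_deriv_bend_t_le {M : ℝ} (hM : 0 < M) {C : ℝ} (hC : ∀ u : ℝ, |deriv Real.smoothTransition u| ≤ C)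
    (hC0 : 0 ≤ C) {t r : ℝ} (ht : 0 < t) (hr : 2 * M < r) :
    |deriv (fun t ↦ bend M t r) t| ≤ C * torH M (2 * exactRadius M t) / t := by
  rw [(hasDerivAt_bend_t hM t r).deriv]
  set S := exactRadius M t with hSdef
  set S' := deriv (exactRadius M) t with hS'def
  have hS0 : 0 < S := exactRadius_pos hM t
  have hS'0 : 0 ≤ S' := deriv_exactRadius_nonneg hM ht.le
  have hS'le : S' * (2 * t) ≤ S := deriv_exactRadius_mul_le hM ht
  have hTS : 0 ≤ torH M (2 * S) :=
    torH_nonneg hM (by rw [hSdef, exactRadius_eq]; linarith [le_growth hM t])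
  -- off the transition annulus the `χ'` factor vanishes
  by_cases hzone : exactRadius M t < r ∧ r < 2 * exactRadius M t
  · obtain ⟨h1, h2⟩ := hzone
    have hr4 : 4 * M ≤ r := by
      rw [exactRadius_eq] at h1; linarith [le_growth hM t]
    have htor : |torH M r| ≤ torH M (2 * S) := by
      rw [abs_of_nonneg (torH_nonneg hM hr4)]
      exact torH_le_torH hM hr h2.le
    have hr0 : 0 ≤ r := by linarith
    have hfrac : |(-(r * S') / S ^ 2)| ≤ 2 * S' / S := by
      rw [abs_div, abs_neg, abs_of_nonneg (mul_nonneg hr0 hS'0), abs_of_nonneg (sq_nonneg S)]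
      rw [div_le_div_iff₀ (by positivity) hS0]
      nlinarith [mul_nonneg (mul_nonneg (by linarith : (0 : ℝ) ≤ 2 * S - r) hS'0) hS0.le]
    have hprod : |deriv Real.smoothTransition (r / S - 1)| * |(-(r * S') / S ^ 2)| ≤ C * (2 * S' / S) :=
      mul_le_mul (hC _) hfrac (abs_nonneg _) hC0
    have hrate : S' * 2 / S ≤ 1 / t := by
      rw [div_le_div_iff₀ hS0 ht]
      linarith
    calc |torH M r * (deriv Real.smoothTransition (r / S - 1) * (-(r * S') / S ^ 2))|
        = |torH M r| * (|deriv Real.smoothTransition (r / S - 1)| * |(-(r * S') / S ^ 2)|) := by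
          rw [abs_mul, abs_mul]
      _ ≤ torH M (2 * S) * (C * (2 * S' / S)) :=
          mul_le_mul htor hprod (mul_nonneg (abs_nonneg _) (abs_nonneg _)) hTS
      _ = C * torH M (2 * S) * (S' * 2 / S) := by ring
      _ ≤ C * torH M (2 * S) * (1 / t) := mul_le_mul_of_nonneg_left hrate (mul_nonneg hC0 hTS)
      _ = C * torH M (2 * S) / t := by ring
  · -- `χ' (r/S − 1) = 0`
    have hu : r / S - 1 ≤ 0 ∨ 1 ≤ r / S - 1 := by
      rcases not_and_or.1 hzone with h | h
      · left
        rw [sub_nonpos, div_le_one hS0]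
        exact not_lt.1 h
      · right
        rw [le_sub_iff_add_le, le_div_iff₀ hS0]
        linarith [not_lt.1 h]
    rw [deriv_smoothTransition_eq_zero hu, zero_mul, mul_zero, abs_zero]
    positivity

/-- **Choice of the late time.** There is `τ♭ ≥ 25M` (depending only on `M` and the bound `C` on `χ'`)
such that for `t ≥ τ♭` and `r > 2M`: `|∂_t bend M t r| ≤ 1/2` and `torH(2S(t)) ≤ t`. -/
theorem exists_lateTime {M : ℝ} (hM : 0 < M) :
    ∃ τ : ℝ, 25 * M ≤ τ ∧ 0 < τ ∧
      (∀ t r : ℝ, τ ≤ t → 2 * M < r → |deriv (fun t ↦ bend M t r) t| ≤ 1 / 2) ∧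
      (∀ t : ℝ, τ ≤ t → torH M (2 * exactRadius M t) ≤ t) := by
  obtain ⟨C, hC0, hC⟩ := exists_bound_deriv_smoothTransition
  -- `σ₀ = max 25 (28C + 1)²`, `τ = M σ₀`
  set σ₀ : ℝ := max 25 ((64 * C + 1) ^ 2) with hσ₀
  have hσ25 : 25 ≤ σ₀ := le_max_left _ _
  have hσC : (64 * C + 1) ^ 2 ≤ σ₀ := le_max_right _ _
  refine ⟨M * σ₀, by nlinarith, by positivity, ?_, ?_⟩
  · intro t r ht hr
    have ht0 : 0 < t := by nlinarith
    have hσ : σ₀ ≤ t / M := by rw [le_div_iff₀ hM]; linarith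
    refine (abs_deriv_bend_t_le hM hC hC0 ht0 hr).trans ?_
    have h1 := torH_two_mul_exactRadius_le hM ht0.le
    -- `√(7 + 4√σ) ≤ √11 · σ^{1/4} ≤ …`; we use the cruder chain `7 + 4√σ ≤ 11 √σ` (σ ≥ 1) and
    -- `√(11√σ) ≤ √11 √(√σ)`, then `C · 4M √11 σ^{1/4} / (M σ) ≤ 1/2` iff `8 √11 C ≤ σ^{3/4}`, implied by
    -- `√σ ≥ 28C + 1` (as `σ^{3/4} ≥ √σ` for `σ ≥ 1` and `8√11 < 28`).
    set σ := t / M with hσdef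
    have hσ1 : 1 ≤ σ := by linarith
    have hsq : Real.sqrt σ ≥ 64 * C + 1 := by
      have : Real.sqrt ((64 * C + 1) ^ 2) ≤ Real.sqrt σ := Real.sqrt_le_sqrt (hσC.trans hσ)
      rwa [Real.sqrt_sq (by positivity)] at this
    have hsq1 : 1 ≤ Real.sqrt σ := Real.one_le_sqrt.2 hσ1
    have hA : Real.sqrt (7 + 4 * Real.sqrt σ) ≤ 4 * Real.sqrt (Real.sqrt σ) := by
      rw [show 4 * Real.sqrt (Real.sqrt σ) = Real.sqrt (16 * Real.sqrt σ) by
        rw [Real.sqrt_mul (by norm_num), show Real.sqrt 16 = 4 by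
          rw [show (16 : ℝ) = 4 ^ 2 by norm_num, Real.sqrt_sq (by norm_num)]]]
      exact Real.sqrt_le_sqrt (by linarith)
    have ht' : t = M * σ := by rw [hσdef]; field_simp
    -- `torH(2S)/t ≤ 16 M √√σ / (M σ) = 16 √√σ/σ`
    have hB : C * torH M (2 * exactRadius M t) / t ≤ C * (16 * Real.sqrt (Real.sqrt σ)) / σ := by
      rw [ht']
      have hden : 0 < M * σ := by positivity
      rw [div_le_div_iff₀ hden (by linarith)]
      have : torH M (2 * exactRadius M (M * σ)) ≤ 4 * M * (4 * Real.sqrt (Real.sqrt σ)) := by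
        rw [← ht']; exact h1.trans (by gcongr)
      calc C * torH M (2 * exactRadius M (M * σ)) * σ ≤ C * (4 * M * (4 * Real.sqrt (Real.sqrt σ))) * σ := by
            gcongr
        _ = C * (16 * Real.sqrt (Real.sqrt σ)) * (M * σ) := by ring
    refine hB.trans ?_
    -- `16 C √√σ ≤ σ/2` ⇐ `32 C ≤ √√σ · √σ… `; use `√σ = √√σ · √√σ` and `√√σ ≥ 1`, `√σ ≥ 28C + 1 ≥ …`
    have hss1 : 1 ≤ Real.sqrt (Real.sqrt σ) := Real.one_le_sqrt.2 hsq1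
    have e1 : Real.sqrt σ * Real.sqrt σ = σ := Real.mul_self_sqrt (by linarith)
    have e2 : Real.sqrt (Real.sqrt σ) * Real.sqrt (Real.sqrt σ) = Real.sqrt σ := Real.mul_self_sqrt (by positivity)
    rw [div_le_iff₀ (by linarith)]
    -- `16 C √√σ ≤ 16 C √σ ≤ (64 C + 1) √σ / 2 ≤ σ/2`
    have k1 : (64 * C + 1) * Real.sqrt σ ≤ σ := by nlinarith [e1, hsq, hsq1]
    have k2 : Real.sqrt (Real.sqrt σ) ≤ Real.sqrt σ := by nlinarith [e2, hss1]
    have k3 : C * Real.sqrt (Real.sqrt σ) ≤ C * Real.sqrt σ := mul_le_mul_of_nonneg_left k2 hC0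
    have k4 : 0 ≤ C * Real.sqrt σ := mul_nonneg hC0 (by linarith)
    nlinarith [k1, k3, k4, hsq1]
  · intro t ht
    have ht0 : 0 < t := by nlinarith
    set σ := t / M with hσdef
    have hσ : σ₀ ≤ σ := by rw [hσdef, le_div_iff₀ hM]; linarith
    have hσ1 : 25 ≤ σ := hσ25.trans hσ
    have hsq5 : 5 ≤ Real.sqrt σ := by
      rw [show (5 : ℝ) = Real.sqrt 25 by rw [show (25 : ℝ) = 5 ^ 2 by norm_num, Real.sqrt_sq (by norm_num)]]
      exact Real.sqrt_le_sqrt hσ1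
    refine (torH_two_mul_exactRadius_le hM ht0.le).trans ?_
    have ht' : t = M * σ := by rw [hσdef]; field_simp
    -- `4 √(7 + 4 s) ≤ s²` for `s = √σ ≥ 5` (`σ = s²`): `16(7 + 4s) ≤ s⁴` since `s⁴ ≥ 125 s ≥ 64 s + 112`.
    set s := Real.sqrt σ with hs
    have hσs : σ = s ^ 2 := by rw [hs, Real.sq_sqrt (by linarith)]
    have h4 : Real.sqrt (7 + 4 * s) ≤ s ^ 2 / 4 := by
      rw [show s ^ 2 / 4 = Real.sqrt ((s ^ 2 / 4) ^ 2) by rw [Real.sqrt_sq (by positivity)]]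
      refine Real.sqrt_le_sqrt ?_
      nlinarith [hsq5, sq_nonneg s, mul_pos (by norm_num : (0 : ℝ) < 5) (by linarith : (0 : ℝ) < s)]
    rw [ht', hσs]
    nlinarith [h4, hM, mul_le_mul_of_nonneg_left h4 (by positivity : (0 : ℝ) ≤ 4 * M)]

/-! ## Consequences: strict monotonicity of the fibre maps, nonnegative static time of the image -/

/-- **The fibre maps `t ↦ t + bend M t r` are strictly increasing on `[τ♭, ∞)`** (derivative `≥ 1/2`). -/
theorem strictMonoOn_add_bend {M : ℝ} (hM : 0 < M) {τ : ℝ}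
    (hτ : ∀ t r : ℝ, τ ≤ t → 2 * M < r → |deriv (fun t ↦ bend M t r) t| ≤ 1 / 2) {r : ℝ} (hr : 2 * M < r) :
    StrictMonoOn (fun t ↦ t + bend M t r) (Set.Ici τ) := by
  have hdiff : ∀ t, HasDerivAt (fun t ↦ t + bend M t r) (1 + deriv (fun t ↦ bend M t r) t) t := fun t ↦
    (hasDerivAt_id t).add (hasDerivAt_bend_t hM t r).differentiableAt.hasDerivAt
  refine strictMonoOn_of_deriv_pos (convex_Ici τ)
    (fun t _ ↦ (hdiff t).continuousAt.continuousWithinAt) fun t ht ↦ ?_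
  rw [interior_Ici] at ht
  rw [(hdiff t).deriv]
  have := hτ t r ht.le hr
  have := neg_abs_le (deriv (fun t ↦ bend M t r) t)
  linarith

/-- The fibre maps dominate the identity (`bend ≥ 0`). -/
theorem le_add_bend {M : ℝ} (hM : 0 < M) (t r : ℝ) : t ≤ t + bend M t r :=
  le_add_of_nonneg_right (bend_nonneg t r hM)

/-- **Nonnegative static time of the bent image**: for `t ≥ τ♭` (with `torH(2S(t)) ≤ t`) and `r > 2M`,
`t + bend M t r − torH M r ≥ 0`. -/
theorem staticTime_bent_nonneg {M : ℝ} (hM : 0 < M) {τ : ℝ}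
    (hτ : ∀ t : ℝ, τ ≤ t → torH M (2 * exactRadius M t) ≤ t) (hτ0 : 0 ≤ τ)
    {t r : ℝ} (ht : τ ≤ t) (hr : 2 * M < r) : 0 ≤ t + bend M t r - torH M r := by
  by_cases h4 : 4 * M ≤ r
  · have := torH_sub_bend_le (t := t) hM h4
    have := hτ t ht
    linarith
  · have hneg : torH M r ≤ 0 := torH_nonpos hM hr (not_le.1 h4).le
    have := bend_nonneg t r hM
    linarith

/-- **IVT on the fibres**: if `τ₁ + bend M τ₁ r < T` then some `t > τ₁` has `t + bend M t r = T`
(continuity, and `s ≤ s + bend`). -/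
theorem exists_add_bend_eq {M : ℝ} (hM : 0 < M) {r τ₁ T : ℝ} (hT : τ₁ + bend M τ₁ r < T) :
    ∃ t : ℝ, τ₁ < t ∧ t + bend M t r = T := by
  have hcont : Continuous fun t ↦ t + bend M t r :=
    continuous_id.add (continuous_iff_continuousAt.2 fun t ↦ (hasDerivAt_bend_t hM t r).continuousAt)
  have hτT : τ₁ ≤ T := by linarith [bend_nonneg τ₁ r hM]
  have hmem : T ∈ Set.Icc (τ₁ + bend M τ₁ r) (T + bend M T r) :=
    ⟨hT.le, le_add_of_nonneg_right (bend_nonneg T r hM)⟩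
  obtain ⟨t, ht, htT⟩ := intermediate_value_Icc hτT hcont.continuousOn hmem
  refine ⟨t, lt_of_le_of_ne ht.1 ?_, htT⟩
  rintro rfl
  exact (lt_irrefl _) (htT ▸ hT)

/-- **Anchor of part 5** (registered sub-goal of `stub_regionOneDecomposition`): after a late time the hole
chart's fibre maps `t ↦ t + bend M t r` are strictly increasing. -/
theorem regionOneBend_anchor : ∀ (M : ℝ), 0 < M → ∃ τ : ℝ, 0 < τ ∧ ∀ r : ℝ, 2 * M < r → StrictMonoOn (fun t ↦ t + bend M t r) (Set.Ici τ) := by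
  intro M hM
  obtain ⟨τ, -, hτ0, hmono, -⟩ := exists_lateTime hM
  exact ⟨τ, hτ0, fun r hr ↦ strictMonoOn_add_bend hM hmono hr⟩

end Summit.FinalStateConjecture.FinalStateConjecture.Theorems.SwallowTheDatum.UniversalWitnessFamily

end
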